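import Literature.NumberTheory.LFunctions.ZeroDensityIngham
import Literature.NumberTheory.LFunctions.ZeroDensityNearOne
import Literature.Computability.Cryptography.HallgrenClassGroupDivisorSums
import HarnessLib

/-!
# Tools for the near-`σ = 1` density theorem: the `σ`-uniform counting layer (logarithms kept) and the divisor-square coefficient bound

NOT RH-BEARING. Bookkeeping for zero-density theorems: a density theorem counts zeros off the critical
line, it never empties the strip (`Literature.Barriers.RiemannHypothesis.LindelofBacklund`); RH-free
literature. bears_on: LADDER-RH §4 HELD row `DensityLadder` (corpus C4: the near-`σ = 1` density
discharge `ZeroDensityNearOneProofs.lean`). Nothing here bears on the truth of RH.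

Topic `Literature/NumberTheory/LFunctions`; namespace `Literature.NumberTheory.LFunctions.ZeroDensity`
(as the counting layer of `ZeroDensityInghamTools.lean`). Pure-proof file (theorems only).

The tree's counting layer (`ZeroDensity.WellSpacedBound`, `ZeroDensity.count_dyadic_le`,
`ZeroDensity.isBigO_of_dyadic`; Ivić 1985 §11.2 (11.11)–(11.12)) turns a bound `C U^κ` for
`1`-separated sets of zeros `β ≥ σ`, `U < γ ≤ 2U` into `N(σ, 2U) − N(σ, U) ≪ U^κ log U` and then into
the per-`σ` asymptotic `N(σ, T) = O_δ(T^{κ+δ})`. A density theorem whose exponent and constants must be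
UNIFORM in `σ` near `1` and which carries powers of `log T` that cannot be absorbed into `T^{κ}`
(`κ = B(1−σ)^{3/2} → 0`; Ivić Thm. 11.3, Montgomery 1971 Thm. 12.3) needs the same two steps with
(a) the well-spaced bound assumed only AT the height `U` in question (an arbitrary number `M`, so that
`M = C U^κ (log U)^p`, or a bound valid only for `U ≥ U₀(σ)`, can be fed in), and (b) an explicit
telescoping over the dyadic blocks with the logarithms kept and no `=O`:

* `count_dyadic_le_of_local` — if every `1`-separated set of zeros with `β ≥ σ`, `U < γ ≤ 2U` has at
  most `M` elements (`U ≥ 1`, `σ ≥ 1/4`), then `N(σ, 2U) − N(σ, U) ≤ 2 M · C_w log(2U + 3)`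
  (verbatim the proof of `ZeroDensity.count_dyadic_le`: group by `⌊γ⌋`, unit-window count, parity);
* `zetaZeroCountRe_dyadic_telescope` — `N(σ, T) ≤ N(σ, T/2^J) + ∑_{j<J} (N(σ, T/2^j) − N(σ, T/2^{j+1}))`
  written as an inequality against any majorants of the block increments;
* `zetaZeroCountRe_le_of_blocks` — if `N(σ, 2U) − N(σ, U) ≤ R` for all `U₀ ≤ U ≤ T/2` then
  `N(σ, T) ≤ N(σ, 2U₀) + R · (log T / log 2 + 1)` (`1 ≤ U₀`, `2U₀ ≤ T`): the number of dyadic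
  blocks is at most `log₂ T + 1`, costing one logarithm instead of the geometric-series constant
  `1/(2^κ − 1)` of `isBigO_of_dyadic`, which is unbounded as `κ → 0`;
* `sum_norm_sq_rpow_le_of_norm_le_divisors` — the mean-square coefficient sum of Halász's lemma
  (`G = ∑_{M<n≤2M} |b(n)|² n^{−2σ}` in `HalaszTuranLH.halasz_block_count`) for divisor-bounded
  coefficients `|b(n)| ≤ d(n)` (e.g. `ZeroDensity.coeffB`): `G ≤ 2 M^{1−2σ} (1 + log 2M)³`, by the
  elementary `∑_{n≤A} d(n)² ≤ A(1 + log A)³` (tree: `Hallgren2005.sum_card_divisors_sq_le`). Near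
  `σ = 1` this replaces the divisor bound `d(n) ≤ C_ε n^ε` of the Lindelöf-hypothesis proof
  (`HalaszTuranDensityProofs.lean`), whose constant `C_ε` is not uniform as `ε = O(1 − σ) → 0`;
* `zetaZeroCountRe_le_of_wellSpaced_uniform` — **the σ-uniform counting assembly**: a well-spaced
  block bound `#Z ≤ A U^{e(σ)} (log U)^{C'}` for `1`-separated zeros `β ≥ σ`, `U < γ ≤ 2U`, valid for
  all `U ≥ U₀` and all `σ₁ ≤ σ < 1` with ONE `A, C', U₀` (any exponent function `e ≥ 0`), gives
  `N(σ, T) ≤ T^{e(σ)} (log T)^{C'+3}` for all `T ≥ T₀`, `σ₁ ≤ σ < 1`, with ONE `T₀`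
  (`count_dyadic_le_of_local` + `zetaZeroCountRe_le_of_blocks`; the `O(1)` zeros below `2U₀` and all
  constants are absorbed by one power of `log T`). Used with `e(σ) = 2(1−σ)` (log-power density of
  density-hypothesis strength near `σ = 1`, `ZeroDensityNearOneLogPower.lean`) and with
  `e(σ) = B(1−σ)^{3/2}` (road to `NearOneZeroDensity`, next item);
* `nearOneZeroDensity_of_wellSpaced` — **the counting half of the near-one density theorem**: the
  previous item with `e(σ) = B'(1−σ)^{3/2}` on `[1 − η₁, 1)`, the trivial bound `N(σ,T) ≪ T log T ≤ T²`
  below `1 − η₁` (`B ≥ 2/η₁^{3/2}`) and `N(1, T) = 0` give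
  `Literature.NumberTheory.LFunctions.NearOneZeroDensity`; this reduces `nearOneZeroDensity_holds`
  (`ZeroDensityNearOneProofs.lean`) to the zero-detection + Halász–Montgomery block count at a line
  `Re s = α` close to `1` with the Richert-type bound.

## References

* A. Ivić, *The Riemann Zeta-Function* (1985), §11.2, (11.11)–(11.12) (representatives `1`-apart and
  unit windows), §11.4 Thm. 11.3 (where the `σ`-uniform, log-carrying form is used). [Ivic1985]
* H. L. Montgomery, R. C. Vaughan, *Multiplicative Number Theory I* (2007), Thm. 10.13 (zeros in a
  unit window, the input `exists_sum_zetaZeroWindow_le`); §2.1 / (1.80)-type elementary bound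
  `∑_{n≤x} d(n)² ≪ x log³ x` (Ivić (1.80); here in the explicit form of the tree's
  `Hallgren2005.sum_card_divisors_sq_le`). [MontgomeryVaughan2007] [Ivic1985]
-/

noncomputable section

open Finset Real Complex Filter

namespace Literature.NumberTheory.LFunctions

namespace ZeroDensity

/-- **Representatives and windows, local form** (Ivić (11.11)–(11.12)): if every set of zeros
`ρ` of `ζ` with `Re ρ ≥ σ`, `U < Im ρ ≤ 2U` and ordinates pairwise `≥ 1` apart has at most `M`
elements (`U ≥ 1`, `σ ≥ 1/4`), then `N(σ, 2U) − N(σ, U) ≤ 2 M · C_w log(2U + 3)`, where `C_w` is the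
constant of the unit-window count `∑_{|Im ρ − τ| ≤ 1/2} m(ρ) ≤ C_w log(|τ| + 2)`
(`Literature.NumberTheory.LFunctions.exists_sum_zetaZeroWindow_le`). Same proof as
`ZeroDensity.count_dyadic_le` (which assumes the bound `C U^κ` at every height): group the zeros by
`⌊Im ρ⌋`, bound each group by the window count, choose one zero per group and split the groups by
the parity of `⌊Im ρ⌋` to obtain two `1`-separated sets. [cite: Ivic1985, §11.2 (11.11)–(11.12)] -/
theorem count_dyadic_le_of_local {σ : ℝ} (hσ : 1 / 4 ≤ σ) {U M : ℝ} (hU : 1 ≤ U)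
    (hws : ∀ Z : Finset ℂ,
      (∀ ρ ∈ Z, riemannZeta ρ = 0 ∧ σ ≤ ρ.re ∧ U < ρ.im ∧ ρ.im ≤ 2 * U) →
      (∀ ρ ∈ Z, ∀ ρ' ∈ Z, ρ ≠ ρ' → 1 ≤ |ρ.im - ρ'.im|) → (Z.card : ℝ) ≤ M)
    {Cw : ℝ} (hCw : ∀ τ : ℝ, ∑ ρ ∈ (LFunctions.zetaZeroWindow_finite τ).toFinset,
      (riemannZetaZeroOrder ρ : ℝ) ≤ Cw * Real.log (|τ| + 2)) :
    (zetaZeroCountRe σ (2 * U) : ℝ) - zetaZeroCountRe σ U ≤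
      2 * M * (Cw * Real.log (2 * U + 3)) := by
  classical
  set B₁ := (zetaZeroBox_finite σ U).toFinset with hB₁
  set B₂ := (zetaZeroBox_finite σ (2 * U)).toFinset with hB₂
  have hsub : B₁ ⊆ B₂ := by
    intro ρ hρ
    rw [hB₁, Set.Finite.mem_toFinset] at hρ
    rw [hB₂, Set.Finite.mem_toFinset]
    obtain ⟨h0, h1, h2, h3, h4⟩ := hρ
    exact ⟨h0, h1, h2, h3, by linarith⟩
  set D := B₂ \ B₁ with hD
  have hDmem : ∀ ρ ∈ D, riemannZeta ρ = 0 ∧ σ ≤ ρ.re ∧ ρ.re ≤ 1 ∧ U < ρ.im ∧ ρ.im ≤ 2 * U := by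
    intro ρ hρ
    rw [hD, Finset.mem_sdiff, hB₂, hB₁, Set.Finite.mem_toFinset, Set.Finite.mem_toFinset] at hρ
    obtain ⟨⟨h0, h1, h2, h3, h4⟩, hn⟩ := hρ
    refine ⟨h0, h1, h2, ?_, h4⟩
    by_contra hle
    exact hn ⟨h0, h1, h2, h3, not_lt.1 hle⟩
  have hdiff : (zetaZeroCountRe σ (2 * U) : ℝ) - zetaZeroCountRe σ U =
      ∑ ρ ∈ D, (riemannZetaZeroOrder ρ : ℝ) := by
    rw [natCast_zetaZeroCountRe, natCast_zetaZeroCountRe, ← hB₁, ← hB₂,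
      ← Finset.sum_sdiff hsub, hD]
    ring
  rw [hdiff]
  -- group by `k = ⌊Im ρ⌋`
  set f : ℂ → ℤ := fun ρ ↦ ⌊ρ.im⌋ with hf
  set Kset := D.image f with hKset
  have hfib : ∀ k ∈ Kset, ∑ ρ ∈ D with f ρ = k, (riemannZetaZeroOrder ρ : ℝ) ≤
      Cw * Real.log (2 * U + 3) := by
    intro k hk
    have hk0 : (1 : ℝ) ≤ k := by
      rw [hKset, Finset.mem_image] at hk
      obtain ⟨ρ, hρ, rfl⟩ := hk
      have h1 : (1 : ℤ) ≤ ⌊ρ.im⌋ := Int.le_floor.2 (by push_cast; linarith [(hDmem ρ hρ).2.2.2.1])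
      exact_mod_cast h1
    have hkU : (k : ℝ) ≤ 2 * U := by
      rw [hKset, Finset.mem_image] at hk
      obtain ⟨ρ, hρ, rfl⟩ := hk
      exact (Int.floor_le ρ.im).trans (hDmem ρ hρ).2.2.2.2
    set τ : ℝ := (k : ℝ) + 1 / 2 with hτ
    have hsubw : D.filter (fun ρ ↦ f ρ = k) ⊆ (LFunctions.zetaZeroWindow_finite τ).toFinset := by
      intro ρ hρ
      rw [Finset.mem_filter] at hρ
      rw [Set.Finite.mem_toFinset]
      obtain ⟨hρD, hρk⟩ := hρ
      obtain ⟨h0, h1, -, -, -⟩ := hDmem ρ hρD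
      refine ⟨h0, hσ.trans h1, ?_⟩
      have hfl := Int.floor_le ρ.im
      have hlt := Int.lt_floor_add_one ρ.im
      rw [show f ρ = ⌊ρ.im⌋ from rfl] at hρk
      rw [hρk] at hfl hlt
      rw [hτ, abs_le]
      constructor <;> linarith
    calc ∑ ρ ∈ D with f ρ = k, (riemannZetaZeroOrder ρ : ℝ)
        ≤ ∑ ρ ∈ (LFunctions.zetaZeroWindow_finite τ).toFinset, (riemannZetaZeroOrder ρ : ℝ) := by
          refine Finset.sum_le_sum_of_subset_of_nonneg hsubw fun ρ hρ _ ↦ ?_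
          rw [Set.Finite.mem_toFinset] at hρ
          exact LFunctions.riemannZetaZeroOrder_nonneg_of_zero hρ.1
      _ ≤ Cw * Real.log (|τ| + 2) := hCw τ
      _ ≤ Cw * Real.log (2 * U + 3) := by
          have hCw0 : 0 ≤ Cw := by
            have h := hCw 0
            have h0 : (0 : ℝ) ≤ ∑ ρ ∈ (LFunctions.zetaZeroWindow_finite 0).toFinset,
                (riemannZetaZeroOrder ρ : ℝ) := Finset.sum_nonneg fun ρ hρ ↦ by
              rw [Set.Finite.mem_toFinset] at hρ
              exact LFunctions.riemannZetaZeroOrder_nonneg_of_zero hρ.1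
            have hl : 0 < Real.log (|(0 : ℝ)| + 2) := by simp; exact Real.log_pos (by norm_num)
            nlinarith
          refine mul_le_mul_of_nonneg_left (Real.log_le_log (by positivity) ?_) hCw0
          rw [hτ, abs_of_pos (by linarith)]
          linarith
  -- number of groups
  have hcardK : (Kset.card : ℝ) ≤ 2 * M := by
    -- a section of `f` on `Kset`
    have hex : ∀ k ∈ Kset, ∃ ρ ∈ D, f ρ = k := fun k hk ↦ by
      simpa [hKset, Finset.mem_image] using hk
    choose! g hgD hgf using hex
    have hginj : Set.InjOn g Kset := by
      intro k hk k' hk' h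
      rw [← hgf k hk, ← hgf k' hk', h]
    -- parity classes
    have hclass : ∀ P : Finset ℤ, P ⊆ Kset → (∀ k ∈ P, ∀ k' ∈ P, k ≠ k' → 2 ≤ |k - k'|) →
        (P.card : ℝ) ≤ M := by
      intro P hP hP2
      have hcard : (P.image g).card = P.card := Finset.card_image_of_injOn (hginj.mono hP)
      rw [← hcard]
      refine hws (P.image g) (fun ρ hρ ↦ ?_) (fun ρ hρ ρ' hρ' hne ↦ ?_)
      · rw [Finset.mem_image] at hρ
        obtain ⟨k, hk, rfl⟩ := hρ
        obtain ⟨h0, h1, -, h3, h4⟩ := hDmem _ (hgD k (hP hk))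
        exact ⟨h0, h1, h3, h4⟩
      · rw [Finset.mem_image] at hρ hρ'
        obtain ⟨k, hk, rfl⟩ := hρ
        obtain ⟨k', hk', rfl⟩ := hρ'
        have hkk : k ≠ k' := fun h ↦ hne (by rw [h])
        have h2 := hP2 k hk k' hk' hkk
        have e1 : ⌊(g k).im⌋ = k := hgf k (hP hk)
        have e2 : ⌊(g k').im⌋ = k' := hgf k' (hP hk')
        have hfl := Int.floor_le (g k).im
        have hlt := Int.lt_floor_add_one (g k).im
        have hfl' := Int.floor_le (g k').im
        have hlt' := Int.lt_floor_add_one (g k').im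
        rw [e1] at hfl hlt
        rw [e2] at hfl' hlt'
        have h2' : (2 : ℝ) ≤ |(k : ℝ) - k'| := by exact_mod_cast h2
        rcases le_total (k : ℝ) k' with hle | hle
        · rw [abs_of_nonpos (by linarith)] at h2'
          rw [abs_of_nonpos (by linarith)]
          linarith
        · rw [abs_of_nonneg (by linarith)] at h2'
          rw [abs_of_nonneg (by linarith)]
          linarith
    have hE := hclass (Kset.filter (fun k ↦ Even k)) (Finset.filter_subset _ _) (by
      intro k hk k' hk' hne
      rw [Finset.mem_filter] at hk hk'
      have : Even (k - k') := Int.even_sub.2 (iff_of_true hk.2 hk'.2)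
      obtain ⟨r, hr⟩ := this
      rw [hr, show r + r = 2 * r by ring, abs_mul, abs_two]
      have : r ≠ 0 := by rintro rfl; simp at hr; exact hne (by linarith)
      have : 1 ≤ |r| := Int.one_le_abs this
      linarith)
    have hO := hclass (Kset.filter (fun k ↦ ¬ Even k)) (Finset.filter_subset _ _) (by
      intro k hk k' hk' hne
      rw [Finset.mem_filter] at hk hk'
      have : Even (k - k') := Int.even_sub.2 (iff_of_false hk.2 hk'.2)
      obtain ⟨r, hr⟩ := this
      rw [hr, show r + r = 2 * r by ring, abs_mul, abs_two]
      have : r ≠ 0 := by rintro rfl; simp at hr; exact hne (by linarith)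
      have : 1 ≤ |r| := Int.one_le_abs this
      linarith)
    have hsplit := Finset.card_filter_add_card_filter_not (s := Kset) (fun k ↦ Even k)
    have : (Kset.card : ℝ) = ((Kset.filter (fun k ↦ Even k)).card : ℝ) +
        ((Kset.filter (fun k ↦ ¬ Even k)).card : ℝ) := by exact_mod_cast hsplit.symm
    rw [this]
    linarith
  -- assemble
  have hmaps : ∀ ρ ∈ D, f ρ ∈ Kset := fun ρ hρ ↦ Finset.mem_image_of_mem f hρ
  rw [← Finset.sum_fiberwise_of_maps_to hmaps]
  have hlog0 : 0 ≤ Cw * Real.log (2 * U + 3) := by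
    have h := hfib
    rcases Kset.eq_empty_or_nonempty with hK | ⟨k, hk⟩
    · -- irrelevant in this case; prove directly
      have hCw0 : 0 ≤ Cw := by
        have h := hCw 0
        have h0 : (0 : ℝ) ≤ ∑ ρ ∈ (LFunctions.zetaZeroWindow_finite 0).toFinset,
            (riemannZetaZeroOrder ρ : ℝ) := Finset.sum_nonneg fun ρ hρ ↦ by
          rw [Set.Finite.mem_toFinset] at hρ
          exact LFunctions.riemannZetaZeroOrder_nonneg_of_zero hρ.1
        have hl : 0 < Real.log (|(0 : ℝ)| + 2) := by simp; exact Real.log_pos (by norm_num)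
        nlinarith
      exact mul_nonneg hCw0 (Real.log_nonneg (by linarith))
    · refine le_trans (Finset.sum_nonneg fun ρ hρ ↦ ?_) (hfib k hk)
      rw [Finset.mem_filter] at hρ
      exact LFunctions.riemannZetaZeroOrder_nonneg_of_zero (hDmem ρ hρ.1).1
  calc ∑ k ∈ Kset, ∑ ρ ∈ D with f ρ = k, (riemannZetaZeroOrder ρ : ℝ)
      ≤ ∑ k ∈ Kset, Cw * Real.log (2 * U + 3) := Finset.sum_le_sum hfib
    _ = Kset.card * (Cw * Real.log (2 * U + 3)) := by rw [Finset.sum_const, nsmul_eq_mul]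
    _ ≤ 2 * M * (Cw * Real.log (2 * U + 3)) :=
        mul_le_mul_of_nonneg_right hcardK hlog0


/-- **Dyadic telescoping, explicit**: for any `J` and majorants `R j` of the block increments
`N(σ, T/2^j) − N(σ, T/2^{j+1})` (`j < J`), `N(σ, T) ≤ N(σ, T/2^J) + ∑_{j<J} R j`.
[cite: Ivic1985, §11.2 (11.11)–(11.12)] -/
theorem zetaZeroCountRe_dyadic_telescope (σ T : ℝ) (J : ℕ) (R : ℕ → ℝ)
    (h : ∀ j < J, (zetaZeroCountRe σ (T / 2 ^ j) : ℝ) - zetaZeroCountRe σ (T / 2 ^ (j + 1)) ≤ R j) :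
    (zetaZeroCountRe σ T : ℝ) ≤ zetaZeroCountRe σ (T / 2 ^ J) + ∑ j ∈ Finset.range J, R j := by
  induction J with
  | zero => simp
  | succ J ih =>
    have h1 := ih (fun j hj => h j (Nat.lt_succ_of_lt hj))
    have h2 := h J (Nat.lt_succ_self J)
    rw [Finset.sum_range_succ]
    linarith

/-- **From dyadic blocks to `N(σ, T)`, keeping the logarithm**: if `N(σ, 2U) − N(σ, U) ≤ R` for every
`U` with `U₀ ≤ U` and `2U ≤ T` (`U₀ ≥ 1`, `R ≥ 0`), then
`N(σ, T) ≤ N(σ, 2U₀) + R (log T / log 2 + 1)` for `T ≥ 2U₀`: at most `log₂ T + 1` dyadic blocks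
`(T/2^{j+1}, T/2^j]` lie above height `U₀`, and what is below `2U₀` is counted by `N(σ, 2U₀)`
(monotonicity in `T`). [cite: Ivic1985, §11.2 (11.11)–(11.12)] -/
theorem zetaZeroCountRe_le_of_blocks {σ T U₀ R : ℝ} (hU₀ : 1 ≤ U₀) (hT : 2 * U₀ ≤ T) (hR : 0 ≤ R)
    (h : ∀ U : ℝ, U₀ ≤ U → 2 * U ≤ T →
      (zetaZeroCountRe σ (2 * U) : ℝ) - zetaZeroCountRe σ U ≤ R) :
    (zetaZeroCountRe σ T : ℝ) ≤ zetaZeroCountRe σ (2 * U₀) + R * (Real.log T / Real.log 2 + 1) := by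
  have hT0 : 0 < T := by linarith
  have hlog2 : 0 < Real.log 2 := Real.log_pos (by norm_num)
  -- `J` = the number of halvings keeping `T/2^J ≥ U₀`: the least `J` with `T/2^(J+1) < U₀`... we take
  -- `J := ⌊log₂ (T/U₀)⌋₊`, so that `U₀ ≤ T/2^J < 2U₀`.
  set J : ℕ := ⌊Real.log (T / U₀) / Real.log 2⌋₊ with hJ
  have hTU : 1 ≤ T / U₀ := by rw [le_div_iff₀ (by linarith)]; linarith
  have hlogTU : 0 ≤ Real.log (T / U₀) := Real.log_nonneg hTU
  have hJle : (J : ℝ) ≤ Real.log (T / U₀) / Real.log 2 := Nat.floor_le (by positivity)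
  have hJlt : Real.log (T / U₀) / Real.log 2 < J + 1 := Nat.lt_floor_add_one _
  -- `2^J ≤ T/U₀ < 2^(J+1)`
  have hpowJ : (2 : ℝ) ^ J ≤ T / U₀ := by
    have h1 : (J : ℝ) * Real.log 2 ≤ Real.log (T / U₀) := by
      rwa [le_div_iff₀ hlog2] at hJle
    have h2 : Real.log ((2 : ℝ) ^ J) ≤ Real.log (T / U₀) := by rwa [Real.log_pow]
    exact (Real.log_le_log_iff (by positivity) (by positivity)).1 h2
  have hpowJ1 : T / U₀ < (2 : ℝ) ^ (J + 1) := by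
    have h1 : Real.log (T / U₀) < ((J : ℝ) + 1) * Real.log 2 := by
      rwa [div_lt_iff₀ hlog2] at hJlt
    have h2 : Real.log (T / U₀) < Real.log ((2 : ℝ) ^ (J + 1)) := by
      rw [Real.log_pow]; push_cast; exact h1
    exact (Real.log_lt_log_iff (by positivity) (by positivity)).1 h2
  -- the blocks `U_j = T/2^(j+1)`, `j < J`, satisfy `U₀ ≤ U_j` and `2 U_j = T/2^j ≤ T`
  have hblocks : ∀ j < J, (zetaZeroCountRe σ (T / 2 ^ j) : ℝ)
      - zetaZeroCountRe σ (T / 2 ^ (j + 1)) ≤ R := by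
    intro j hj
    have hU : U₀ ≤ T / 2 ^ (j + 1) := by
      rw [le_div_iff₀ (by positivity)]
      have h1 : (2 : ℝ) ^ (j + 1) ≤ 2 ^ J := pow_le_pow_right₀ (by norm_num) hj
      have h2 : U₀ * 2 ^ J ≤ T := by
        rw [le_div_iff₀ (by linarith)] at hpowJ; linarith
      nlinarith
    have h2U : 2 * (T / 2 ^ (j + 1)) = T / 2 ^ j := by
      rw [pow_succ]; field_simp
    have h2UT : 2 * (T / 2 ^ (j + 1)) ≤ T := by
      rw [h2U]
      exact div_le_self hT0.le (one_le_pow₀ (by norm_num))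
    have := h (T / 2 ^ (j + 1)) hU h2UT
    rwa [h2U] at this
  have htel := zetaZeroCountRe_dyadic_telescope σ T J (fun _ => R) hblocks
  -- the bottom block: `T/2^J < 2U₀`
  have hbot : (zetaZeroCountRe σ (T / 2 ^ J) : ℝ) ≤ zetaZeroCountRe σ (2 * U₀) := by
    have h1 : T / 2 ^ J ≤ 2 * U₀ := by
      rw [div_le_iff₀ (by positivity)]
      rw [div_lt_iff₀ (by linarith)] at hpowJ1
      rw [pow_succ] at hpowJ1
      linarith
    exact_mod_cast zetaZeroCountRe_mono_right_holds σ h1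
  -- the number of blocks: `J ≤ log₂ T` (as `U₀ ≥ 1`)
  have hJT : (J : ℝ) ≤ Real.log T / Real.log 2 := by
    refine hJle.trans (div_le_div_of_nonneg_right ?_ hlog2.le)
    exact Real.log_le_log (by positivity) (div_le_self hT0.le hU₀)
  rw [Finset.sum_const, Finset.card_range, nsmul_eq_mul] at htel
  have hJR : (J : ℝ) * R ≤ R * (Real.log T / Real.log 2 + 1) := by nlinarith
  linarith

/-- **The coefficient mean square in Halász's lemma for divisor-bounded coefficients**: if
`|b(n)| ≤ d(n)` for all `n`, then for `M ≥ 1`, `σ ≥ 0`,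
`∑_{M<n≤2M} |b(n)|² n^{−2σ} ≤ 2 M^{1−2σ} (1 + log 2M)³` (`n^{−2σ} ≤ M^{−2σ}` on the block and
`∑_{n≤2M} d(n)² ≤ 2M (1 + log 2M)³`). This is the quantity `G` of
`HalaszTuranLH.halasz_block_count`; it is the step `R² ≪ log²Y (∑_{M<n≤2M} d²(n) e^{−2n/Y} n^{−2σ})(…) ⇒ R² ≪ log⁵T (R M^{2−2σ} + …)` of Ivić's proof of Theorem 11.3 (p. 280, between (11.46) and (11.47)). [cite: Ivic1985, §11.4, proof of Theorem 11.3, display after (11.46), p. 280] -/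
theorem sum_norm_sq_rpow_le_of_norm_le_divisors {b : ℕ → ℂ}
    (hb : ∀ n : ℕ, ‖b n‖ ≤ (n.divisors.card : ℝ)) {M : ℕ} (hM : 1 ≤ M) {σ : ℝ} (hσ : 0 ≤ σ) :
    ∑ n ∈ Finset.Ioc M (2 * M), ‖b n‖ ^ 2 * (n : ℝ) ^ (-2 * σ)
      ≤ 2 * (M : ℝ) ^ (1 - 2 * σ) * (1 + Real.log ((2 * M : ℕ) : ℝ)) ^ 3 := by
  have hM0 : (0 : ℝ) < M := by exact_mod_cast hM
  have hterm : ∀ n ∈ Finset.Ioc M (2 * M),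
      ‖b n‖ ^ 2 * (n : ℝ) ^ (-2 * σ) ≤ (M : ℝ) ^ (-2 * σ) * ((n.divisors.card ^ 2 : ℕ) : ℝ) := by
    intro n hn
    rw [Finset.mem_Ioc] at hn
    have hn0 : (M : ℝ) ≤ n := by exact_mod_cast hn.1.le
    have h1 : ‖b n‖ ^ 2 ≤ ((n.divisors.card ^ 2 : ℕ) : ℝ) := by
      push_cast
      exact pow_le_pow_left₀ (norm_nonneg _) (hb n) 2
    have h2 : (n : ℝ) ^ (-2 * σ) ≤ (M : ℝ) ^ (-2 * σ) :=
      Real.rpow_le_rpow_of_nonpos hM0 hn0 (by linarith)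
    calc ‖b n‖ ^ 2 * (n : ℝ) ^ (-2 * σ) ≤ ((n.divisors.card ^ 2 : ℕ) : ℝ) * (M : ℝ) ^ (-2 * σ) :=
          mul_le_mul h1 h2 (by positivity) (by positivity)
      _ = (M : ℝ) ^ (-2 * σ) * ((n.divisors.card ^ 2 : ℕ) : ℝ) := mul_comm _ _
  have hsub : Finset.Ioc M (2 * M) ⊆ Finset.Icc 1 (2 * M) := by
    intro n hn
    rw [Finset.mem_Ioc] at hn
    rw [Finset.mem_Icc]
    omega
  have hH := Literature.Computability.Cryptography.Hallgren2005.sum_card_divisors_sq_le (2 * M)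
  calc ∑ n ∈ Finset.Ioc M (2 * M), ‖b n‖ ^ 2 * (n : ℝ) ^ (-2 * σ)
      ≤ ∑ n ∈ Finset.Ioc M (2 * M), (M : ℝ) ^ (-2 * σ) * ((n.divisors.card ^ 2 : ℕ) : ℝ) :=
        Finset.sum_le_sum hterm
    _ = (M : ℝ) ^ (-2 * σ) * ∑ n ∈ Finset.Ioc M (2 * M), ((n.divisors.card ^ 2 : ℕ) : ℝ) := by
        rw [Finset.mul_sum]
    _ ≤ (M : ℝ) ^ (-2 * σ) * ∑ n ∈ Finset.Icc 1 (2 * M), ((n.divisors.card ^ 2 : ℕ) : ℝ) := by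
        apply mul_le_mul_of_nonneg_left _ (by positivity)
        exact Finset.sum_le_sum_of_subset_of_nonneg hsub fun n _ _ => by positivity
    _ ≤ (M : ℝ) ^ (-2 * σ) * (((2 * M : ℕ) : ℝ) * (1 + Real.log ((2 * M : ℕ) : ℝ)) ^ 3) := by
        apply mul_le_mul_of_nonneg_left _ (by positivity)
        rw [← Nat.cast_sum]
        exact hH
    _ = 2 * (M : ℝ) ^ (1 - 2 * σ) * (1 + Real.log ((2 * M : ℕ) : ℝ)) ^ 3 := by
        rw [show (1 : ℝ) - 2 * σ = 1 + (-2 * σ) by ring, Real.rpow_add hM0, Real.rpow_one]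
        push_cast
        ring


/-! ### The `σ`-uniform counting assembly -/

/-- `4 C₀ log T ≤ T` for `T ≥ 64 C₀² + 1` (`log T ≤ 2√T`). [folklore] -/
private theorem four_mul_log_le_self {C₀ T : ℝ} (hC₀ : 0 ≤ C₀) (hT : 64 * C₀ ^ 2 + 1 ≤ T) :
    4 * C₀ * Real.log T ≤ T := by
  have hT0 : 0 < T := by nlinarith
  have hsqrt : 0 < Real.sqrt T := Real.sqrt_pos.mpr hT0
  have hlog : Real.log T ≤ 2 * Real.sqrt T := by
    have h1 : Real.log (Real.sqrt T) ≤ Real.sqrt T - 1 := Real.log_le_sub_one_of_pos hsqrt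
    have h2 : Real.log T = 2 * Real.log (Real.sqrt T) := by
      conv_lhs => rw [← Real.mul_self_sqrt hT0.le]
      rw [Real.log_mul hsqrt.ne' hsqrt.ne']; ring
    linarith
  have h8 : 8 * C₀ ≤ Real.sqrt T := by
    rw [show 8 * C₀ = Real.sqrt ((8 * C₀) ^ 2) by rw [Real.sqrt_sq (by positivity)]]
    exact Real.sqrt_le_sqrt (by nlinarith)
  calc 4 * C₀ * Real.log T ≤ 4 * C₀ * (2 * Real.sqrt T) := by
        exact mul_le_mul_of_nonneg_left hlog (by positivity)
    _ = 8 * C₀ * Real.sqrt T := by ring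
    _ ≤ Real.sqrt T * Real.sqrt T := mul_le_mul_of_nonneg_right h8 hsqrt.le
    _ = T := Real.mul_self_sqrt hT0.le

/-- **The `σ`-uniform counting assembly** (Ivić §11.2 (11.11)–(11.12), run with explicit constants):
if for some `σ₁ ≥ 1/4`, `A ≥ 0`, `C' ≥ 0`, `U₀ ≥ 1` and an exponent function `e(σ) ≥ 0` every set of
zeros `ρ` of `ζ` with `Re ρ ≥ σ`, `U < Im ρ ≤ 2U`, ordinates pairwise `≥ 1` apart, has at most
`A U^{e(σ)} (log U)^{C'}` elements — for ALL `U ≥ U₀` and ALL `σ₁ ≤ σ < 1` — then there is ONE `T₀ ≥ 1`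
with `N(σ, T) ≤ T^{e(σ)} (log T)^{C'+3}` for all `T ≥ T₀` and all `σ₁ ≤ σ < 1`: at most `log₂ T + 1`
dyadic blocks (`zetaZeroCountRe_le_of_blocks`), each counted by `count_dyadic_le_of_local`
(`≤ 2 A T^{e(σ)}(log T)^{C'} · C_w log(2T+3)`), plus `N(σ, 2U₀) ≤ C₀ (2U₀+2) log(2U₀+2)`; every
constant is absorbed by one `log T` (`log T ≥ K₀ + 12 A C_w + 1`).
[cite: Ivic1985, §11.2 (11.11)–(11.12)] -/
theorem zetaZeroCountRe_le_of_wellSpaced_uniform {σ₁ A C' U₀ : ℝ} {e : ℝ → ℝ}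
    (hσ₁ : 1 / 4 ≤ σ₁) (hA : 0 ≤ A) (hC' : 0 ≤ C') (hU₀ : 1 ≤ U₀)
    (he : ∀ σ : ℝ, σ₁ ≤ σ → σ < 1 → 0 ≤ e σ)
    (hmid : ∀ U : ℝ, U₀ ≤ U → ∀ σ : ℝ, σ₁ ≤ σ → σ < 1 → ∀ Z : Finset ℂ,
      (∀ ρ ∈ Z, riemannZeta ρ = 0 ∧ σ ≤ ρ.re ∧ U < ρ.im ∧ ρ.im ≤ 2 * U) →
      (∀ ρ ∈ Z, ∀ ρ' ∈ Z, ρ ≠ ρ' → 1 ≤ |ρ.im - ρ'.im|) →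
      (Z.card : ℝ) ≤ A * U ^ e σ * Real.log U ^ C') :
    ∃ T₀ : ℝ, 1 ≤ T₀ ∧ ∀ T : ℝ, T₀ ≤ T → ∀ σ : ℝ, σ₁ ≤ σ → σ < 1 →
      (zetaZeroCountRe σ T : ℝ) ≤ T ^ e σ * Real.log T ^ (C' + 3) := by
  obtain ⟨Cw, hCw0, hCw⟩ := LFunctions.exists_sum_zetaZeroWindow_le
  obtain ⟨C₀, hC₀0, hC₀⟩ := exists_zetaZeroCountRe_le_mul_log
  -- the `O(1)` zeros below height `2U₀`
  set K₀ : ℝ := C₀ * (2 * U₀ + 2) * Real.log (2 * U₀ + 2) with hK₀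
  have hK₀0 : 0 ≤ K₀ := by
    rw [hK₀]
    exact mul_nonneg (mul_nonneg hC₀0.le (by linarith)) (Real.log_nonneg (by linarith))
  set T₀ : ℝ := max (max (2 * U₀) 4) (Real.exp (12 * A * Cw + K₀ + 1)) with hT₀
  refine ⟨T₀, le_trans (by linarith) (le_trans (le_max_left _ _) (le_max_left _ _)),
    fun T hT σ hσ hσ1 => ?_⟩
  -- unpack `T ≥ T₀`
  have hT2U₀ : 2 * U₀ ≤ T := le_trans (le_max_left _ _) (le_trans (le_max_left _ _) hT)
  have hT4 : 4 ≤ T := le_trans (le_max_right _ _) (le_trans (le_max_left _ _) hT)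
  have hTexp : Real.exp (12 * A * Cw + K₀ + 1) ≤ T := le_trans (le_max_right _ _) hT
  have hT1 : 1 ≤ T := by linarith
  have hT0 : 0 < T := by linarith
  set L : ℝ := Real.log T with hL
  have hL12 : 12 * A * Cw + K₀ + 1 ≤ L := by
    rw [hL, Real.le_log_iff_exp_le hT0]; exact hTexp
  have hACw : 0 ≤ 12 * A * Cw := by positivity
  have hL1 : 1 ≤ L := by linarith
  have hL0 : 0 ≤ L := by linarith
  have hlog2T : Real.log (2 * T + 3) ≤ 2 * L := by
    have h : 2 * T + 3 ≤ T ^ 2 := by nlinarith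
    calc Real.log (2 * T + 3) ≤ Real.log (T ^ 2) := Real.log_le_log (by linarith) h
      _ = 2 * L := by rw [Real.log_pow]; push_cast; ring
  -- the exponent
  set κ : ℝ := e σ with hκ
  have hκ0 : 0 ≤ κ := he σ hσ hσ1
  set M : ℝ := A * T ^ κ * L ^ C' with hM
  have hM0 : 0 ≤ M := by positivity
  set R : ℝ := 2 * M * (Cw * Real.log (2 * T + 3)) with hR
  have hlog2T0 : 0 ≤ Real.log (2 * T + 3) := Real.log_nonneg (by linarith)
  have hR0 : 0 ≤ R := by positivity
  have hσ4 : 1 / 4 ≤ σ := hσ₁.trans hσ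
  -- per-block bound
  have hblock : ∀ U : ℝ, U₀ ≤ U → 2 * U ≤ T →
      (zetaZeroCountRe σ (2 * U) : ℝ) - zetaZeroCountRe σ U ≤ R := by
    intro U hU hUT
    have hU1 : 1 ≤ U := hU₀.trans hU
    have hUT' : U ≤ T := by linarith
    have hMU : A * U ^ κ * Real.log U ^ C' ≤ M := by
      apply mul_le_mul (mul_le_mul_of_nonneg_left (Real.rpow_le_rpow (by linarith) hUT' hκ0) hA)
        (Real.rpow_le_rpow (Real.log_nonneg hU1) (Real.log_le_log (by linarith) hUT') hC')
        (Real.rpow_nonneg (Real.log_nonneg hU1) _) (by positivity)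
    have hloc := count_dyadic_le_of_local hσ4 hU1
      (M := A * U ^ κ * Real.log U ^ C') (fun Z hZ hsep => hmid U hU σ hσ hσ1 Z hZ hsep) hCw
    calc (zetaZeroCountRe σ (2 * U) : ℝ) - zetaZeroCountRe σ U
        ≤ 2 * (A * U ^ κ * Real.log U ^ C') * (Cw * Real.log (2 * U + 3)) := hloc
      _ ≤ 2 * M * (Cw * Real.log (2 * T + 3)) := by
          apply mul_le_mul (by linarith) (mul_le_mul_of_nonneg_left
            (Real.log_le_log (by linarith) (by linarith)) hCw0.le)
            (mul_nonneg hCw0.le (Real.log_nonneg (by linarith))) (by positivity)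
  have hmain := zetaZeroCountRe_le_of_blocks (σ := σ) hU₀ hT2U₀ hR0 hblock
  -- the bottom part
  have hbot : (zetaZeroCountRe σ (2 * U₀) : ℝ) ≤ K₀ := hC₀ σ hσ4 (2 * U₀) (by linarith)
  -- bookkeeping: `K₀ + R (L/log 2 + 1) ≤ T^κ L^{C'+3}`
  have hlog2 : (0.6931471803 : ℝ) < Real.log 2 := Real.log_two_gt_d9
  have hlog2pos : 0 < Real.log 2 := by linarith
  have hfac : L / Real.log 2 + 1 ≤ 3 * L := by
    have h1 : L / Real.log 2 ≤ 2 * L := by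
      rw [div_le_iff₀ hlog2pos]; nlinarith [hlog2, hL0]
    linarith
  have hTκ1 : 1 ≤ T ^ κ := Real.one_le_rpow hT1 hκ0
  have hLC1 : 1 ≤ L ^ C' := Real.one_le_rpow hL1 hC'
  have hLC2 : L ^ (C' + 3) = L ^ C' * L ^ 3 := by
    rw [Real.rpow_add (by linarith), show (3 : ℝ) = ((3 : ℕ) : ℝ) by norm_num, Real.rpow_natCast]
  set P : ℝ := T ^ κ * L ^ C' with hP
  have hP1 : 1 ≤ P := one_le_mul_of_one_le_of_one_le hTκ1 hLC1
  have hP0 : 0 ≤ P := by linarith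
  have hPL : 1 ≤ P * L ^ 2 := one_le_mul_of_one_le_of_one_le hP1 (one_le_pow₀ hL1)
  have hMP : M = A * P := by rw [hM, hP]; ring
  have hR1 : R ≤ 4 * Cw * (A * P) * L := by
    calc R = 2 * M * (Cw * Real.log (2 * T + 3)) := rfl
      _ ≤ 2 * M * (Cw * (2 * L)) :=
          mul_le_mul_of_nonneg_left (mul_le_mul_of_nonneg_left hlog2T hCw0.le) (by positivity)
      _ = 4 * Cw * (A * P) * L := by rw [hMP]; ring
  have hRle : R * (L / Real.log 2 + 1) ≤ 12 * A * Cw * (P * L ^ 2) := by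
    calc R * (L / Real.log 2 + 1) ≤ R * (3 * L) := mul_le_mul_of_nonneg_left hfac hR0
      _ ≤ (4 * Cw * (A * P) * L) * (3 * L) := mul_le_mul_of_nonneg_right hR1 (by positivity)
      _ = 12 * A * Cw * (P * L ^ 2) := by ring
  have hK₀le : K₀ ≤ K₀ * (P * L ^ 2) := le_mul_of_one_le_right hK₀0 hPL
  have htot : K₀ + R * (L / Real.log 2 + 1) ≤ T ^ κ * L ^ (C' + 3) := by
    calc K₀ + R * (L / Real.log 2 + 1) ≤ K₀ * (P * L ^ 2) + 12 * A * Cw * (P * L ^ 2) :=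
          add_le_add hK₀le hRle
      _ = (K₀ + 12 * A * Cw) * (P * L ^ 2) := by ring
      _ ≤ L * (P * L ^ 2) := mul_le_mul_of_nonneg_right (by linarith) (by positivity)
      _ = T ^ κ * L ^ (C' + 3) := by rw [hLC2, hP]; ring
  linarith

/-! ### From `σ`-uniform well-spaced block bounds to `NearOneZeroDensity` -/

/-- **The counting half of the near-`σ = 1` density theorem** (Ivić, proof of Thm. 11.3: (11.47) for
representatives `log`-apart, then "`N(σ, T)` … by (11.11)–(11.12)"): suppose that for some
`0 < η₁ ≤ 1/2`, `B' > 0`, `C' ≥ 0`, `U₀ ≥ 1`, every set of zeros `ρ` of `ζ` with `Re ρ ≥ σ`,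
`U < Im ρ ≤ 2U`, ordinates pairwise `≥ 1` apart, has at most `U^{B'(1−σ)^{3/2}} (log U)^{C'}` elements,
for all `U ≥ U₀` and all `1 − η₁ ≤ σ < 1` (the output of the zero-detection + Halász–Montgomery step,
UNIFORM in `σ`). Then `NearOneZeroDensity` holds (with `B = max B' (2/η₁^{3/2})`, `C = C' + 3`):
for `1 − η₁ ≤ σ < 1` by `zetaZeroCountRe_le_of_wellSpaced_uniform`, for `1/2 ≤ σ < 1 − η₁` by the
trivial bound `N(σ, T) ≤ C₀ (T+2) log(T+2) ≤ T² ≤ T^{B(1−σ)^{3/2}}` (`exists_zetaZeroCountRe_le_mul_log`),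
and for `σ = 1` by `N(1, T) = 0`. [cite: Ivic1985, §11.4, proof of Theorem 11.3 ((11.47) and (11.11)–(11.12))] -/
theorem nearOneZeroDensity_of_wellSpaced {η₁ B' C' U₀ : ℝ} (hη₁ : 0 < η₁) (hη₁' : η₁ ≤ 1 / 2)
    (hB' : 0 < B') (hC' : 0 ≤ C') (hU₀ : 1 ≤ U₀)
    (hmid : ∀ U : ℝ, U₀ ≤ U → ∀ σ : ℝ, 1 - η₁ ≤ σ → σ < 1 → ∀ Z : Finset ℂ,
      (∀ ρ ∈ Z, riemannZeta ρ = 0 ∧ σ ≤ ρ.re ∧ U < ρ.im ∧ ρ.im ≤ 2 * U) →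
      (∀ ρ ∈ Z, ∀ ρ' ∈ Z, ρ ≠ ρ' → 1 ≤ |ρ.im - ρ'.im|) →
      (Z.card : ℝ) ≤ U ^ (B' * (1 - σ) ^ (3 / 2 : ℝ)) * Real.log U ^ C') :
    NearOneZeroDensity := by
  obtain ⟨C₀, hC₀0, hC₀⟩ := exists_zetaZeroCountRe_le_mul_log
  -- the middle regime from the uniform assembly (`A = 1`, `e σ = B'(1−σ)^{3/2}`)
  obtain ⟨T₁, hT₁1, hT₁⟩ := zetaZeroCountRe_le_of_wellSpaced_uniform (σ₁ := 1 - η₁) (A := 1)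
    (e := fun σ => B' * (1 - σ) ^ (3 / 2 : ℝ)) (by linarith) zero_le_one hC' hU₀
    (fun σ _ hσ1 => mul_nonneg hB'.le (Real.rpow_nonneg (by linarith) _))
    (fun U hU σ hσ hσ1 Z hZ hsep => by rw [one_mul]; exact hmid U hU σ hσ hσ1 Z hZ hsep)
  set B : ℝ := max B' (2 / η₁ ^ (3 / 2 : ℝ)) with hB
  have hη32 : 0 < η₁ ^ (3 / 2 : ℝ) := Real.rpow_pos_of_pos hη₁ _
  have hB0 : 0 < B := lt_max_of_lt_left hB'
  set T₀ : ℝ := max (max T₁ 4) (64 * C₀ ^ 2 + 1) with hT₀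
  refine ⟨B, C' + 3, T₀, hB0, fun T hT σ hσ hσ1 => ?_⟩
  have hTT₁ : T₁ ≤ T := le_trans (le_max_left _ _) (le_trans (le_max_left _ _) hT)
  have hT4 : 4 ≤ T := le_trans (le_max_right _ _) (le_trans (le_max_left _ _) hT)
  have hT64 : 64 * C₀ ^ 2 + 1 ≤ T := le_trans (le_max_right _ _) hT
  have hT1 : 1 ≤ T := by linarith
  have hT0 : 0 < T := by linarith
  set L : ℝ := Real.log T with hL
  have hL1 : 1 ≤ L := by
    rw [hL, Real.le_log_iff_exp_le hT0]
    linarith [Real.exp_one_lt_d9]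
  have hL0 : 0 ≤ L := by linarith
  have hlogT2 : Real.log (T + 2) ≤ 2 * L := by
    have h : T + 2 ≤ T ^ 2 := by nlinarith
    calc Real.log (T + 2) ≤ Real.log (T ^ 2) := Real.log_le_log (by linarith) h
      _ = 2 * L := by rw [Real.log_pow]; push_cast; ring
  have hpow0 : 0 ≤ (1 - σ) ^ (3 / 2 : ℝ) := Real.rpow_nonneg (by linarith) _
  have hκ'0 : 0 ≤ B * (1 - σ) ^ (3 / 2 : ℝ) := mul_nonneg hB0.le hpow0
  have hRHS0 : 0 ≤ T ^ (B * (1 - σ) ^ (3 / 2 : ℝ)) * L ^ (C' + 3) := by positivity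
  have hLC : 1 ≤ L ^ (C' + 3) := Real.one_le_rpow hL1 (by linarith)
  rcases eq_or_lt_of_le hσ1 with hσeq | hσlt
  · -- `σ = 1`
    rw [hσeq, zetaZeroCountRe_eq_zero_of_one_le le_rfl]
    simpa [hσeq] using hRHS0
  rcases lt_or_ge σ (1 - η₁) with hlow | hmidσ
  · -- trivial regime `σ < 1 − η₁`
    have hN := hC₀ σ (by linarith) T hT1
    have h1 : C₀ * (T + 2) * Real.log (T + 2) ≤ 4 * C₀ * L * T := by
      have h2 : T + 2 ≤ 2 * T := by linarith
      calc C₀ * (T + 2) * Real.log (T + 2) ≤ C₀ * (2 * T) * (2 * L) := by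
            apply mul_le_mul (mul_le_mul_of_nonneg_left h2 hC₀0.le) hlogT2
              (Real.log_nonneg (by linarith)) (by positivity)
        _ = 4 * C₀ * L * T := by ring
    have h3 : 4 * C₀ * L * T ≤ T * T :=
      mul_le_mul_of_nonneg_right (four_mul_log_le_self hC₀0.le hT64) hT0.le
    have h4 : 2 ≤ B * (1 - σ) ^ (3 / 2 : ℝ) := by
      have h5 : η₁ ^ (3 / 2 : ℝ) ≤ (1 - σ) ^ (3 / 2 : ℝ) :=
        Real.rpow_le_rpow hη₁.le (by linarith) (by norm_num)
      have h6 : 2 / η₁ ^ (3 / 2 : ℝ) ≤ B := le_max_right _ _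
      calc (2 : ℝ) = 2 / η₁ ^ (3 / 2 : ℝ) * η₁ ^ (3 / 2 : ℝ) := by field_simp
        _ ≤ B * (1 - σ) ^ (3 / 2 : ℝ) := mul_le_mul h6 h5 hη32.le hB0.le
    have h7 : T * T ≤ T ^ (B * (1 - σ) ^ (3 / 2 : ℝ)) := by
      rw [show T * T = T ^ (2 : ℝ) by rw [Real.rpow_two, pow_two]]
      exact Real.rpow_le_rpow_of_exponent_le hT1 h4
    have h8 : T ^ (B * (1 - σ) ^ (3 / 2 : ℝ)) ≤ T ^ (B * (1 - σ) ^ (3 / 2 : ℝ)) * L ^ (C' + 3) :=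
      le_mul_of_one_le_right (by positivity) hLC
    linarith
  · -- middle regime
    have h := hT₁ T hTT₁ σ hmidσ hσlt
    have hκle : B' * (1 - σ) ^ (3 / 2 : ℝ) ≤ B * (1 - σ) ^ (3 / 2 : ℝ) :=
      mul_le_mul_of_nonneg_right (le_max_left _ _) hpow0
    have hfin : T ^ (B' * (1 - σ) ^ (3 / 2 : ℝ)) * L ^ (C' + 3)
        ≤ T ^ (B * (1 - σ) ^ (3 / 2 : ℝ)) * L ^ (C' + 3) :=
      mul_le_mul_of_nonneg_right (Real.rpow_le_rpow_of_exponent_le hT1 hκle) (by positivity)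
    exact h.trans hfin

end ZeroDensity

end Literature.NumberTheory.LFunctions
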